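import Summits.HubbardSuperconductivity.HubbardSuperconductivity.Theorems.SeededBrokenRegimeBoseFermiPinned.Negative.LoadBearing
import Summits.HubbardSuperconductivity.HubbardSuperconductivity.Theorems.AposterioriCapRgSeededBrokenRegimeBoseFermiPinnedLoosenedDatum

/-!
# Report glue for crux `SeededBrokenRegimeBoseFermiPinned` (stmt-HubbardSuperconductivity-14047), route AposterioriCapRg

Pure-logic glue shared by EVERY line architecture on record for this crux (`Lines/seed_strength_flow.lean` v5,
`Lines/line_seed_strength_flow.lean` v6, `PostRestatementSkeleton.lean` of the strategist) and invariant under the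
pending restatement of the item (it speaks at FIXED thresholds `(kStar, etaStar)` and a FIXED point `(U, μ)`; no
`∀ etaStar`, no certificate hypothesis).  Landed once here so that skeletons stop re-proving it inline:

* `isCertifiedEnclosure_of_eventually` — MODEL FORM ⇒ CERTIFIED ENCLOSURE: a datum enclosing, for all `L ≥ L₁` and
  `β ≥ β₀(L)`, a tuple realised in ONE admissible frame for all large `M`, is a certified enclosure of the CT report
  `hubbardScaleReportCT` from `max L₁ 1` on (`mem_hubbardScaleReportCTAt_of_eventually`).
* `exists_certificateT_refinement` — tolerances are DIRECTED for the v3 certificate: any two tolerances have a common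
  refinement whose certificates are certificates at both (componentwise `min`; `Negative.certificateT_mono_tol`).  This is
  how a composition of two `∃ Θ`-stubs picks one `Θ`.
* `conclBody_mono` — the `∃ h₀ ∃ D …` body of the crux's conclusion is monotone in the remainder threshold and antitone in
  the stiffness threshold (`MeetsThresholds.mono`).
* `conclBody_of_anchor_of_step` — THE ANCHOR ∧ STEP TAIL: from a datum `D` meeting the thresholds WITH SLACK (gap ratio `20`,
  `(2·kStar, etaStar/2)`, `0 < N_p`, `0 < m₀.fst`), a model-form realisation of a `D`-enclosed tuple at an anchor seed `h₀ > 0`,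
  and model-form realisations of tuples of the factor-two box of `D` at every seed `h ∈ (0, h₀)`, the loosened datum `D'` of
  S7 (`stub_loosenedDatum`, landed) — same scale, patch number, nodal set — meets `(kStar, etaStar)`, has `0 < m₀'.fst`, and is
  a certified enclosure of `hubbardScaleReportCT U μ D' h` for every `h ∈ (0, h₀]`: exactly the `∃ D …` body of the conclusion of
  `SeededBrokenRegimeBoseFermiPinned` (and of every restated variant `…Above η₀` / `…At k₀ η₀`), with `D'.scale = D.scale` kept for
  scale-capped variants.

No model content (the analytic obligations ANCHOR / STEP stay hypotheses); sources: folklore bookkeeping on the a-posteriori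
record (format Figueras–Haro–Luque 2016, Thm. 2.5) over the tree's `HubbardScaleData` / `hubbardScaleReportCT` API.
-/

set_option linter.dupNamespace false -- `Summit.<S>.<S>` doubles the summit name (tree convention)

namespace Summit.HubbardSuperconductivity.HubbardSuperconductivity.Theorems.AposterioriCapRgSeededBrokenRegimeBoseFermiPinned

open Summit.HubbardSuperconductivity.HubbardSuperconductivity.Theorems.SeededBrokenRegimeBoseFermiPinned
open Literature.MathematicalPhysics.QuantumLattice Filter

/-- **Model form ⇒ certified enclosure.**  A datum enclosing, for all `L ≥ L₁` (`L ≥ 1`) and `β ≥ β₀(L)`, a tuple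
realised in one admissible frame for all large `M`, is a certified enclosure of the CT report from `max L₁ 1` on. [folklore] -/
theorem isCertifiedEnclosure_of_eventually :
    ∀ (U μ h : ℝ) (D : HubbardScaleData) (L₁ : ℕ), (∀ L : ℕ, L₁ ≤ L → ∀ [NeZero L], ∃ β₀ : ℝ, ∀ β : ℝ, β₀ ≤ β →
      ∃ K' : TrigPolyC4v, IsAdmissibleFrame K' ∧ ∃ p : HubbardScaleData.Parameters D.numPatches, D.Encloses p ∧
      ∀ᶠ M in Filter.atTop, IsRealisedAtCT L M β U μ h K' (D.scale : ℝ) D.numPatches D.nodal p) →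
      D.IsCertifiedEnclosure (hubbardScaleReportCT U μ D h) (max L₁ 1) := by
  intro U μ h D L₁ hreal L hL
  haveI : NeZero L := ⟨by omega⟩
  obtain ⟨β₀, hβ₀⟩ := hreal L (le_of_max_le_left hL)
  refine ⟨β₀, fun β hβ => ?_⟩
  obtain ⟨K', hK', p, hDp, hp⟩ := hβ₀ β hβ
  exact ⟨p, by rw [hubbardScaleReportCT_eq]; exact mem_hubbardScaleReportCTAt_of_eventually hK' hp, hDp⟩

/-- **Tolerances are directed for the v3 certificate**: two tolerances have a common refinement (componentwise `min`)
every certificate at which is a certificate at both. [folklore] -/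
theorem exists_certificateT_refinement :
    ∀ Θ₁ Θ₂ : SymmetricTolerance, ∃ Θ : SymmetricTolerance, ∀ (U μ : ℝ) (π : SymmetricRegimeDataT) (K :
      TrigPolyC4v) (Λ : ℝ) (L₀ : ℕ), symmetricRegimeCertificateT U μ π Θ K Λ L₀ → symmetricRegimeCertificateT U
      μ π Θ₁ K Λ L₀ ∧ symmetricRegimeCertificateT U μ π Θ₂ K Λ L₀ := by
  intro Θ₁ Θ₂
  refine ⟨⟨min Θ₁.mismatch Θ₂.mismatch, lt_min Θ₁.mismatch_pos Θ₂.mismatch_pos,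
    min Θ₁.width Θ₂.width, lt_min Θ₁.width_pos Θ₂.width_pos⟩, ?_⟩
  intro U μ π K Λ L₀ h
  exact ⟨Negative.certificateT_mono_tol (min_le_left _ _) (min_le_left _ _) h,
    Negative.certificateT_mono_tol (min_le_right _ _) (min_le_right _ _) h⟩

/-- **The conclusion body is monotone in the thresholds**: a smaller stiffness threshold `0 ≤ kStar' ≤ kStar` and a
larger remainder threshold `etaStar ≤ etaStar'` are easier. [folklore] -/
theorem conclBody_mono :
    ∀ (U μ : ℝ) (kStar kStar' etaStar etaStar' : ℚ), 0 ≤ kStar' → kStar' ≤ kStar → etaStar ≤ etaStar' → (∃ h₀ :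
      ℝ, 0 < h₀ ∧ ∃ D : HubbardScaleData, D.MeetsThresholds kStar etaStar ∧ 0 < D.numPatches ∧ 0 <
      D.meanFieldDensity.fst ∧ ∀ h ∈ Set.Ioc (0:ℝ) h₀, ∃ L₀' : ℕ, D.IsCertifiedEnclosure (hubbardScaleReportCT U
      μ D h) L₀') → ∃ h₀ : ℝ, 0 < h₀ ∧ ∃ D : HubbardScaleData, D.MeetsThresholds kStar' etaStar' ∧ 0 <
      D.numPatches ∧ 0 < D.meanFieldDensity.fst ∧ ∀ h ∈ Set.Ioc (0:ℝ) h₀, ∃ L₀' : ℕ, D.IsCertifiedEnclosure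
      (hubbardScaleReportCT U μ D h) L₀' := by
  intro U μ kStar kStar' etaStar etaStar' hk' hk he h
  obtain ⟨h₀, hh₀, D, hmeets, hNp, hm, hencl⟩ := h
  exact ⟨h₀, hh₀, D, hmeets.mono hk' hk he, hNp, hm, hencl⟩

/-- **ANCHOR ∧ STEP ⇒ the conclusion body** (the pure-logic tail of every line on this crux).  From a datum `D` meeting the
thresholds with slack (gap ratio `20`, `(2·kStar, etaStar/2)`), `0 < N_p`, `0 < m₀.fst`, an anchor seed `h₀` at which a
`D`-enclosed tuple is realised in model form, and model-form realisations of factor-two-box tuples at every `h ∈ (0, h₀)`, the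
S7-loosened datum `D'` (same scale / patches / nodal set) meets `(kStar, etaStar)`, has `0 < m₀'.fst`, and is a certified
enclosure of the CT report at every `h ∈ (0, h₀]`. [folklore] -/
theorem conclBody_of_anchor_of_step :
    ∀ (U μ : ℝ) (kStar etaStar : ℚ), 0 < kStar → 0 < etaStar → ∀ (D : HubbardScaleData), D.MeetsThresholdsWith
      20 (2 * kStar) (etaStar / 2) → 0 < D.numPatches → 0 < D.meanFieldDensity.fst → ∀ (h₀ : ℝ), (∃ L₁ : ℕ, ∀ L
      : ℕ, L₁ ≤ L → ∀ [NeZero L], ∃ β₀ : ℝ, ∀ β : ℝ, β₀ ≤ β → ∃ K' : TrigPolyC4v, IsAdmissibleFrame K' ∧ ∃ p :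
      HubbardScaleData.Parameters D.numPatches, D.Encloses p ∧ ∀ᶠ M in Filter.atTop, IsRealisedAtCT L M β U μ h₀
      K' (D.scale : ℝ) D.numPatches D.nodal p) → (∀ h ∈ Set.Ioo (0:ℝ) h₀, ∃ L₁ : ℕ, ∀ L : ℕ, L₁ ≤ L → ∀ [NeZero
      L], ∃ β₀ : ℝ, ∀ β : ℝ, β₀ ≤ β → ∃ K' : TrigPolyC4v, IsAdmissibleFrame K' ∧ ∃ p :
      HubbardScaleData.Parameters D.numPatches, ((∀ i, ((D.gap i).fst : ℝ) - 10 * (D.scale : ℝ) ≤ p.gap i ∧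
      p.gap i ≤ ((D.gap i).snd : ℝ) + 10 * (D.scale : ℝ)) ∧ 2 / 3 * (D.stiffness.fst : ℝ) ≤ p.stiffness ∧
      p.stiffness ≤ 2 * (D.stiffness.snd : ℝ) ∧ (D.compressibility.fst : ℝ) / 2 ≤ p.compressibility ∧
      p.compressibility ≤ 2 * (D.compressibility.snd : ℝ) ∧ (D.fermiVelocity.fst : ℝ) / 2 ≤ p.fermiVelocity ∧
      p.fermiVelocity ≤ 4 / 3 * (D.fermiVelocity.snd : ℝ) ∧ (D.gapVelocity.fst : ℝ) / 2 ≤ p.gapVelocity ∧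
      p.gapVelocity ≤ 4 / 3 * (D.gapVelocity.snd : ℝ) ∧ p.remainderNorm ≤ 2 * (D.remainderNorm.snd : ℝ) ∧
      (D.meanFieldDensity.fst : ℝ) / 2 ≤ p.meanFieldDensity ∧ p.meanFieldDensity ≤ 2 * (D.meanFieldDensity.snd :
      ℝ)) ∧ ∀ᶠ M in Filter.atTop, IsRealisedAtCT L M β U μ h K' (D.scale : ℝ) D.numPatches D.nodal p) → ∃ D' :
      HubbardScaleData, D'.scale = D.scale ∧ D'.numPatches = D.numPatches ∧ D'.MeetsThresholds kStar etaStar ∧ 0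
      < D'.numPatches ∧ 0 < D'.meanFieldDensity.fst ∧ ∀ h ∈ Set.Ioc (0:ℝ) h₀, ∃ L₀' : ℕ, D'.IsCertifiedEnclosure
      (hubbardScaleReportCT U μ D' h) L₀' := by
  intro U μ kStar etaStar hk he D hmeets hNp hm h₀ hanchor hstep
  -- loosen the datum (S7, landed)
  obtain ⟨gap', ρ', κ', vF', vΔ', η', m₀', hmeets', hm₀', hencl, hbox⟩ :=
    stub_loosenedDatum D kStar etaStar hk he hmeets hm
  have hΛpos : (0 : ℝ) < (D.scale : ℝ) := D.cast_scale_pos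
  refine ⟨HubbardScaleData.mk D.scale D.scale_pos D.numPatches D.nodal gap' ρ' κ' vF' vΔ' η' m₀', rfl, rfl,
    hmeets', hNp, hm₀', ?_⟩
  intro h hh
  rcases lt_or_eq_of_le hh.2 with hlt | heq
  · -- `h < h₀`: the box tuple of STEP, enclosed by `D'`
    obtain ⟨L₂, hL₂⟩ := hstep h ⟨hh.1, hlt⟩
    refine ⟨max L₂ 1, ?_⟩
    intro L hL
    haveI : NeZero L := ⟨by omega⟩
    obtain ⟨β₀, hβ₀⟩ := hL₂ L (le_of_max_le_left hL)
    refine ⟨β₀, fun β hβ => ?_⟩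
    obtain ⟨K', hK', p, hpbox, hp⟩ := hβ₀ β hβ
    have hη0 : 0 ≤ p.remainderNorm := by
      obtain ⟨M, hM⟩ := hp.exists
      exact hM.remainderNorm_nonneg hΛpos.le
    refine ⟨p, ?_, hbox p hη0 hpbox⟩
    show p ∈ hubbardScaleReportCTAt U μ h (D.scale : ℝ) D.numPatches D.nodal L β
    exact mem_hubbardScaleReportCTAt_of_eventually hK' hp
  · -- `h = h₀`: the anchor tuple itself, enclosed by `D` hence by `D'`
    subst heq
    obtain ⟨L₁, hanchor⟩ := hanchor
    refine ⟨max L₁ 1, ?_⟩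
    intro L hL
    haveI : NeZero L := ⟨by omega⟩
    obtain ⟨β₀, hβ₀⟩ := hanchor L (le_of_max_le_left hL)
    refine ⟨β₀, fun β hβ => ?_⟩
    obtain ⟨K', hK', p, hDp, hp⟩ := hβ₀ β hβ
    refine ⟨p, ?_, hencl p hDp⟩
    show p ∈ hubbardScaleReportCTAt U μ h (D.scale : ℝ) D.numPatches D.nodal L β
    exact mem_hubbardScaleReportCTAt_of_eventually hK' hp

end Summit.HubbardSuperconductivity.HubbardSuperconductivity.Theorems.AposterioriCapRgSeededBrokenRegimeBoseFermiPinned
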